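import Summits.AtomisticToContinuum.HydrodynamicLimit.Theorems.EnskogAdjointDualityAdjointEnskogTestFamilyROperatorKappaOnePrep
import HarnessLib

/-!
# K2R refutation, stub `operatorKappaOne` — preparation 4: the `ℓ = 1` contraction

Route `EnskogAdjointDuality` of `AtomisticToContinuum/HydrodynamicLimit`, crux K2R `AdjointEnskogTestFamilyR`
(stmt-AtomisticToContinuum-11592), line `refutation`, registered stub `stub_operatorKappaOne` (identity (I):
the corrector part `κ` of the test function against `ζ(s) sin(2πx₀) Θ₁^R(v)`,
`Θ₁^R(v) = |v|(1+|v|²)⁻⁴e^{-|v|²/R} v₀`, `ϑ₁^R(E) = √E(1+E)⁻⁴e^{-E/R}`, `ϑ₀^R(E) = (1+E)⁻³e^{-E/R}`).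

**The `ℓ = 1` contraction** (`k2r_ref_ok1_contraction`).  For a continuous `g` with `|g(U)| ≤ C(1+|U|²)`
(in the assembly: the torus average `κ_s`), given the zonal reduction `∫_{S²} I₁^R(U, ν) dσ = U₀ G₁(|U|²)`
(`stub_kernelBridge`) and the kernel estimate (K1) of `stub_kernelDipole` in the form
`e₁(E) = 2G₁(E) − n(√E) ϑ₁^R(E) + (π/5)√E ϑ₁^R(E)`, `∫₀^∞ (1+E)E|e₁| ≤ M₁`, `n(u) = ν(u e₀)`
(`ν = collisionFrequency` is radial, `collisionFrequency_eq_of_norm_eq`):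
`|2∫ g(U) ∫_{S²} I₁^R(U, ω) dσ dU − ∫ Θ₁^R ν g + (π/5) ∫ ϑ₀^R(|U|²) U₀ g| ≤ C(πM₁ + 4π)`.
Ingredients: Fubini on `S² × ℝ³` against the master function (`k2r_ref_ok1_dominated1`), the polar
reduction `∫ |U₀|(1+|U|²)|e₁(|U|²)| dU = π∫₀^∞(1+E)E|e₁|` (`stub_kernelBridge`), the weight identity
`√E ϑ₁^R(E)·√E… : |U| · |U|(1+|U|²)⁻⁴e = ϑ₀^R(|U|²) − (1+|U|²)⁻⁴e^{-|U|²/R}` (registered keyed sub-goal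
`stub_operatorKappaOne_prep4`) and `∫ |U|(1+|U|²)⁻³ dU ≤ 20` (`k2r_ref_radial_le_twenty`).

References: C. Cercignani, R. Illner, M. Pulvirenti, *The Mathematical Theory of Dilute Gases* (1994),
§3.1, §7.2 [CIP1994].
-/

noncomputable section

open MeasureTheory Set Filter Function
open scoped InnerProductSpace Real

namespace Summit.AtomisticToContinuum.HydrodynamicLimit.Theorems.EnskogAdjointDuality

open Literature.MathematicalPhysics.KineticTheory Literature.Analysis.FluidPDE Literature.Analysis.FunctionSpaces
open Literature.Analysis.UnboundedOperators (collisionFrequency)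

/-! ## Two radial facts -/

/-- The weight identity `√(r²) · (√(r²)(1+r²)⁻⁴e^{-r²/R}) = (1+r²)⁻³e^{-r²/R} − (1+r²)⁻⁴e^{-r²/R}`. [folklore] -/
theorem k2r_ref_ok1_weight_identity (R r : ℝ) :
    Real.sqrt (r ^ 2) * (Real.sqrt (r ^ 2) * ((1 + r ^ 2) ^ 4)⁻¹ * Real.exp (-r ^ 2 / R)) =
      ((1 + r ^ 2) ^ 3)⁻¹ * Real.exp (-r ^ 2 / R) - ((1 + r ^ 2) ^ 4)⁻¹ * Real.exp (-r ^ 2 / R) := by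
  have h1 : Real.sqrt (r ^ 2) * Real.sqrt (r ^ 2) = r ^ 2 := Real.mul_self_sqrt (sq_nonneg r)
  have h2 : (1 + r ^ 2) ≠ 0 := by positivity
  calc Real.sqrt (r ^ 2) * (Real.sqrt (r ^ 2) * ((1 + r ^ 2) ^ 4)⁻¹ * Real.exp (-r ^ 2 / R))
      = (Real.sqrt (r ^ 2) * Real.sqrt (r ^ 2)) * ((1 + r ^ 2) ^ 4)⁻¹ * Real.exp (-r ^ 2 / R) := by ring
    _ = _ := by rw [h1]; field_simp; ring

/-- **Registered keyed sub-goal `stub_operatorKappaOne_prep4`** of stub `operatorKappaOne` (line `refutation`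
of crux K2R `AdjointEnskogTestFamilyR`): the weight identity behind the `-π/5` contraction. [folklore] -/
theorem stub_operatorKappaOne_prep4 : ∀ R r : ℝ, Real.sqrt (r ^ 2) * (Real.sqrt (r ^ 2) * ((1 + r ^ 2) ^ 4)⁻¹ * Real.exp (-r ^ 2 / R)) = ((1 + r ^ 2) ^ 3)⁻¹ * Real.exp (-r ^ 2 / R) - ((1 + r ^ 2) ^ 4)⁻¹ * Real.exp (-r ^ 2 / R) :=
  k2r_ref_ok1_weight_identity

/-- `U ↦ |U|(1+|U|²)⁻³` is integrable on `ℝ³` with integral at most `20`. [folklore] -/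
theorem k2r_ref_ok1_norm_inv_cube :
    Integrable (fun U : V3 => ‖U‖ * ((1 + ‖U‖ ^ 2) ^ 3)⁻¹) ∧ ∫ U : V3, ‖U‖ * ((1 + ‖U‖ ^ 2) ^ 3)⁻¹ ≤ 20 := by
  refine k2r_ref_radial_le_twenty (fun r => r * ((1 + r ^ 2) ^ 3)⁻¹)
    (Continuous.continuousOn (by fun_prop (disch := intros; positivity))) fun r hr => ⟨by positivity, ?_⟩
  rw [show r ^ 2 * (r * ((1 + r ^ 2) ^ 3)⁻¹) = r ^ 3 / (1 + r ^ 2) ^ 3 by ring,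
    div_le_iff₀ (by positivity), ← div_eq_inv_mul, le_div_iff₀ (by positivity)]
  nlinarith [sq_nonneg r, sq_nonneg (r ^ 2 - r), hr.le, sq_nonneg (r - 1), pow_pos hr 3, pow_pos hr 4]

/-! ## The contraction -/

variable {Θ₀ Θ₁ : ℝ → V3 → ℝ} {I₀ I₁ : ℝ → V3 → V3 → ℝ}
variable (hΘ₀ : ∀ R v, Θ₀ R v = ((1 + ‖v‖ ^ 2) ^ 3)⁻¹ * Real.exp (-‖v‖ ^ 2 / R))
  (hΘ₁ : ∀ R v, Θ₁ R v = Real.sqrt (‖v‖ ^ 2) * ((1 + ‖v‖ ^ 2) ^ 4)⁻¹ * Real.exp (-‖v‖ ^ 2 / R) * v 0)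
  (hI₀ : ∀ R U n, I₀ R U n = (1 / 2 : ℝ) * Real.exp (-(‖U‖ ^ 2 - ⟪U, n⟫_ℝ ^ 2) / 2) *
    (∫ b, max (⟪U, n⟫_ℝ - b) 0 * (Real.exp (-b ^ 2 / 2) / Real.sqrt (2 * π))) *
    ∫ E in Ioi (⟪U, n⟫_ℝ ^ 2), ((1 + E) ^ 3)⁻¹ * Real.exp (-E / R))
  (hI₁ : ∀ R U n, I₁ R U n = n 0 * ⟪U, n⟫_ℝ * ((1 / 2 : ℝ) * Real.exp (-(‖U‖ ^ 2 - ⟪U, n⟫_ℝ ^ 2) / 2) *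
    (∫ b, max (⟪U, n⟫_ℝ - b) 0 * (Real.exp (-b ^ 2 / 2) / Real.sqrt (2 * π))) *
    ∫ E in Ioi (⟪U, n⟫_ℝ ^ 2), Real.sqrt E * ((1 + E) ^ 4)⁻¹ * Real.exp (-E / R)))
include hΘ₀ hΘ₁ hI₀ hI₁

omit hΘ₀ hI₀ hI₁ in
/-- **The loss piece against the dipole weight.** For continuous `g` with `|g| ≤ C(1+|U|²)`:
`Θ₁^R ν g` is integrable and equals `g(U) U₀ · n(√(|U|²)) ϑ₁^R(|U|²)` pointwise, `n(u) = ν(u e₀)`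
(`ν ≤ π√(|U|²+3)`, `ν` radial). [folklore] -/
theorem k2r_ref_ok1_loss_facts {R : ℝ} (hR : 1 ≤ R) {g : V3 → ℝ} (hg : Continuous g) {C : ℝ}
    (hgb : ∀ U, |g U| ≤ C * (1 + ‖U‖ ^ 2)) :
    Integrable (fun U : V3 => Θ₁ R U * (collisionFrequency U * g U)) ∧
    ∀ U : V3, Θ₁ R U * (collisionFrequency U * g U) = g U * U 0 *
      (collisionFrequency (Real.sqrt (‖U‖ ^ 2) • (EuclideanSpace.single 0 1 : V3)) *
        (Real.sqrt (‖U‖ ^ 2) * ((1 + ‖U‖ ^ 2) ^ 4)⁻¹ * Real.exp (-‖U‖ ^ 2 / R))) := by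
  have hC : 0 ≤ C := by
    have h := hgb 0
    rw [norm_zero] at h
    nlinarith [abs_nonneg (g 0)]
  obtain ⟨-, -, -, -, -, -, -, hi8, -⟩ := k2r_ref_R3_facts hR
  have hcfm := Literature.Analysis.UnboundedOperators.measurable_collisionFrequency (E := V3)
  have hsm : Measurable Real.sqrt := Real.continuous_sqrt.measurable
  have hΘm : Measurable fun v : V3 => Θ₁ R v := by simp only [hΘ₁]; fun_prop
  refine ⟨?_, fun U => ?_⟩
  · refine (hi8.const_mul (3 * Real.pi * C)).mono' ((hΘm.mul (hcfm.mul hg.measurable)).aestronglyMeasurable)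
      (Eventually.of_forall fun U => ?_)
    obtain ⟨hlo, hup, -⟩ := stub_halfGaussian.2.2.2.2.2 U
    have hcf0 : 0 ≤ collisionFrequency U := le_trans (by positivity) hlo
    have hv0 : |U 0| ≤ ‖U‖ := by simpa using PiLp.norm_apply_le U 0
    have hth : 0 ≤ Real.sqrt (‖U‖ ^ 2) * ((1 + ‖U‖ ^ 2) ^ 4)⁻¹ * Real.exp (-‖U‖ ^ 2 / R) := by positivity
    have hsq : Real.sqrt (‖U‖ ^ 2 + 3) ≤ ‖U‖ + 2 := by
      rw [Real.sqrt_le_left (by positivity)]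
      nlinarith [norm_nonneg U]
    have hpoly : Real.sqrt (‖U‖ ^ 2 + 3) * (1 + ‖U‖ ^ 2) ≤ 3 * (1 + ‖U‖ ^ 2) ^ 4 := by
      have h1 : ‖U‖ + 2 ≤ 3 * (1 + ‖U‖ ^ 2) := by nlinarith [sq_nonneg (‖U‖ - 1 / 2), norm_nonneg U]
      have h2 : (1 + ‖U‖ ^ 2) ^ 2 ≤ (1 + ‖U‖ ^ 2) ^ 4 :=
        pow_le_pow_right₀ (by nlinarith [sq_nonneg ‖U‖]) (by norm_num)
      nlinarith [hsq, mul_le_mul_of_nonneg_right h1 (by positivity : (0 : ℝ) ≤ 1 + ‖U‖ ^ 2),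
        Real.sqrt_nonneg (‖U‖ ^ 2 + 3)]
    rw [Real.norm_eq_abs, hΘ₁,
      abs_mul (Real.sqrt (‖U‖ ^ 2) * ((1 + ‖U‖ ^ 2) ^ 4)⁻¹ * Real.exp (-‖U‖ ^ 2 / R) * U 0),
      abs_mul (Real.sqrt (‖U‖ ^ 2) * ((1 + ‖U‖ ^ 2) ^ 4)⁻¹ * Real.exp (-‖U‖ ^ 2 / R)) (U 0), abs_of_nonneg hth,
      abs_mul (collisionFrequency U) (g U), abs_of_nonneg hcf0]
    calc Real.sqrt (‖U‖ ^ 2) * ((1 + ‖U‖ ^ 2) ^ 4)⁻¹ * Real.exp (-‖U‖ ^ 2 / R) * |U 0| *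
          (collisionFrequency U * |g U|)
        ≤ Real.sqrt (‖U‖ ^ 2) * ((1 + ‖U‖ ^ 2) ^ 4)⁻¹ * Real.exp (-‖U‖ ^ 2 / R) * |U 0| *
          (Real.pi * Real.sqrt (‖U‖ ^ 2 + 3) * (C * (1 + ‖U‖ ^ 2))) := by gcongr; exact hgb U
      _ = Real.pi * C * (Real.sqrt (‖U‖ ^ 2) * ((1 + ‖U‖ ^ 2) ^ 4)⁻¹ * Real.exp (-‖U‖ ^ 2 / R) * |U 0|) *
          (Real.sqrt (‖U‖ ^ 2 + 3) * (1 + ‖U‖ ^ 2)) := by ring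
      _ ≤ Real.pi * C * (Real.sqrt (‖U‖ ^ 2) * ((1 + ‖U‖ ^ 2) ^ 4)⁻¹ * Real.exp (-‖U‖ ^ 2 / R) * |U 0|) *
          (3 * (1 + ‖U‖ ^ 2) ^ 4) := by gcongr
      _ = _ := by ring
  · have he : ‖(EuclideanSpace.single 0 1 : V3)‖ = 1 := by simp
    have hn : ‖Real.sqrt (‖U‖ ^ 2) • (EuclideanSpace.single 0 1 : V3)‖ = ‖U‖ := by
      rw [norm_smul, he, mul_one, Real.norm_of_nonneg (Real.sqrt_nonneg _), Real.sqrt_sq (norm_nonneg U)]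
    rw [hΘ₁, ClampedCorrectorBirth.collisionFrequency_eq_of_norm_eq hn.symm]
    ring


/-- **The `ℓ = 1` contraction.** For continuous `g` with `|g(U)| ≤ C(1+|U|²)`, the zonal reduction
`∫_{S²} I₁^R(U, ω) dσ = U₀ G₁(|U|²)` and the kernel estimate `e₁ = 2G₁ − n(√·)ϑ₁^R + (π/5)√· ϑ₁^R`,
`∫₀^∞ (1+E)E|e₁| ≤ M₁` (`n(u) = ν(u e₀)`):
`|2∫ g ∫_{S²} I₁ dσ − ∫ Θ₁^R ν g + (π/5) ∫ ϑ₀^R(|U|²) U₀ g| ≤ C(πM₁ + 4π)`. [cite: CIP1994, §3.1] -/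
theorem k2r_ref_ok1_contraction {R : ℝ} (hR : 1 ≤ R) {g : V3 → ℝ} (hg : Continuous g) {C : ℝ}
    (hgb : ∀ U, |g U| ≤ C * (1 + ‖U‖ ^ 2)) {G1 : ℝ → ℝ}
    (hG1 : ∀ U : V3, ∫ ω : Metric.sphere (0 : V3) 1, I₁ R U ω ∂sphereMeasure = U 0 * G1 (‖U‖ ^ 2))
    {e₁ : ℝ → ℝ} (he₁m : Measurable e₁)
    (he₁ : ∀ E, e₁ E = 2 * G1 E -
      collisionFrequency (Real.sqrt E • (EuclideanSpace.single 0 1 : V3)) *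
        (Real.sqrt E * ((1 + E) ^ 4)⁻¹ * Real.exp (-E / R)) +
      Real.pi / 5 * Real.sqrt E * (Real.sqrt E * ((1 + E) ^ 4)⁻¹ * Real.exp (-E / R)))
    (he₁i : IntegrableOn (fun E => (1 + E) * E * |e₁ E|) (Ioi 0)) {M₁ : ℝ}
    (he₁b : ∫ E in Ioi (0 : ℝ), (1 + E) * E * |e₁ E| ≤ M₁) :
    |2 * (∫ U : V3, g U * ∫ ω : Metric.sphere (0 : V3) 1, I₁ R U ω ∂sphereMeasure) -
        (∫ U : V3, Θ₁ R U * (collisionFrequency U * g U)) +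
        Real.pi / 5 * ∫ U : V3, ((1 + ‖U‖ ^ 2) ^ 3)⁻¹ * Real.exp (-‖U‖ ^ 2 / R) * U 0 * g U| ≤
      C * (Real.pi * M₁ + 4 * Real.pi) := by
  have hC : 0 ≤ C := by
    have h := hgb 0
    rw [norm_zero] at h
    nlinarith [abs_nonneg (g 0)]
  have hR0 : 0 < R := by linarith
  have hsm : Measurable Real.sqrt := Real.continuous_sqrt.measurable
  have hv0 : ∀ U : V3, |U 0| ≤ ‖U‖ := fun U => by simpa using PiLp.norm_apply_le U 0
  have he1 : ∀ U : V3, Real.exp (-‖U‖ ^ 2 / R) ≤ 1 := fun U =>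
    Real.exp_le_one_iff.2 (by rw [neg_div]; exact neg_nonpos.2 (by positivity))
  -- (a) the gain piece: Fubini against the master function and the zonal reduction
  obtain ⟨-, hA, -⟩ := k2r_ref_ok1_dominated1 hΘ₀ hI₀ hI₁ hR hg.measurable hgb
  have hA' : Integrable (fun U : V3 => g U * (U 0 * G1 (‖U‖ ^ 2))) :=
    hA.congr (Eventually.of_forall fun U => by simp only [hG1])
  have eA : (∫ U : V3, g U * ∫ ω : Metric.sphere (0 : V3) 1, I₁ R U ω ∂sphereMeasure) =
      ∫ U : V3, g U * (U 0 * G1 (‖U‖ ^ 2)) := integral_congr_ae (Eventually.of_forall fun U => by simp only [hG1])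
  -- (b) the loss piece
  obtain ⟨hT, hTeq⟩ := k2r_ref_ok1_loss_facts hΘ₁ hR hg hgb
  have hT' : Integrable (fun U : V3 => g U * U 0 *
      (collisionFrequency (Real.sqrt (‖U‖ ^ 2) • (EuclideanSpace.single 0 1 : V3)) *
        (Real.sqrt (‖U‖ ^ 2) * ((1 + ‖U‖ ^ 2) ^ 4)⁻¹ * Real.exp (-‖U‖ ^ 2 / R)))) :=
    hT.congr (Eventually.of_forall hTeq)
  have eT : (∫ U : V3, Θ₁ R U * (collisionFrequency U * g U)) = ∫ U : V3, g U * U 0 *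
      (collisionFrequency (Real.sqrt (‖U‖ ^ 2) • (EuclideanSpace.single 0 1 : V3)) *
        (Real.sqrt (‖U‖ ^ 2) * ((1 + ‖U‖ ^ 2) ^ 4)⁻¹ * Real.exp (-‖U‖ ^ 2 / R))) :=
    integral_congr_ae (Eventually.of_forall hTeq)
  -- (c) the error piece `g U₀ e₁(|U|²)`: polar reduction
  obtain ⟨hpolI, hpolE⟩ := (stub_kernelBridge stub_sphereCalculus.1 R hR).2.2 e₁ he₁m he₁i
  have hE : Integrable (fun U : V3 => g U * U 0 * e₁ (‖U‖ ^ 2)) := by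
    refine (hpolI.const_mul C).mono' (Measurable.aestronglyMeasurable (by fun_prop))
      (Eventually.of_forall fun U => ?_)
    rw [Real.norm_eq_abs, abs_mul, abs_mul]
    calc |g U| * |U 0| * |e₁ (‖U‖ ^ 2)| ≤ C * (1 + ‖U‖ ^ 2) * |U 0| * |e₁ (‖U‖ ^ 2)| := by
          gcongr; exact hgb U
      _ = C * (|U 0| * (1 + ‖U‖ ^ 2) * |e₁ (‖U‖ ^ 2)|) := by ring
  have hEb : |∫ U : V3, g U * U 0 * e₁ (‖U‖ ^ 2)| ≤ C * (Real.pi * M₁) := by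
    have h := norm_integral_le_of_norm_le (hpolI.const_mul C)
      (f := fun U : V3 => g U * U 0 * e₁ (‖U‖ ^ 2)) (Eventually.of_forall fun U => by
        rw [Real.norm_eq_abs, abs_mul, abs_mul]
        calc |g U| * |U 0| * |e₁ (‖U‖ ^ 2)| ≤ C * (1 + ‖U‖ ^ 2) * |U 0| * |e₁ (‖U‖ ^ 2)| := by
              gcongr; exact hgb U
          _ = C * (|U 0| * (1 + ‖U‖ ^ 2) * |e₁ (‖U‖ ^ 2)|) := by ring)
    rw [integral_const_mul, hpolE, Real.norm_eq_abs] at h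
    exact h.trans (mul_le_mul_of_nonneg_left (mul_le_mul_of_nonneg_left he₁b Real.pi_pos.le) hC)
  -- (d) the two weights `g U₀ ϑ₀(|U|²)` and `g U₀ (1+|U|²)⁻⁴e^{-|U|²/R}`
  obtain ⟨hm, -, ⟨hi3, -⟩, -⟩ := k2r_ref_R3_facts hR
  obtain ⟨hi1, -⟩ := hm 1 (by norm_num)
  have hK : Integrable (fun U : V3 => g U * U 0 * (((1 + ‖U‖ ^ 2) ^ 3)⁻¹ * Real.exp (-‖U‖ ^ 2 / R))) := by
    refine ((hi1.add hi3).const_mul C).mono' (Measurable.aestronglyMeasurable (by fun_prop))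
      (Eventually.of_forall fun U => ?_)
    have hth : 0 ≤ ((1 + ‖U‖ ^ 2) ^ 3)⁻¹ * Real.exp (-‖U‖ ^ 2 / R) := by positivity
    rw [Real.norm_eq_abs, abs_mul, abs_mul, abs_of_nonneg hth]
    calc |g U| * |U 0| * (((1 + ‖U‖ ^ 2) ^ 3)⁻¹ * Real.exp (-‖U‖ ^ 2 / R))
        ≤ C * (1 + ‖U‖ ^ 2) * ‖U‖ * (((1 + ‖U‖ ^ 2) ^ 3)⁻¹ * Real.exp (-‖U‖ ^ 2 / R)) := by
          gcongr
          · exact hgb U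
          · exact hv0 U
      _ = _ := by simp only [Pi.add_apply]; ring
  obtain ⟨hDi, hDv⟩ := k2r_ref_ok1_norm_inv_cube
  have hD : Integrable (fun U : V3 => g U * U 0 * (((1 + ‖U‖ ^ 2) ^ 4)⁻¹ * Real.exp (-‖U‖ ^ 2 / R))) := by
    refine (hDi.const_mul C).mono' (Measurable.aestronglyMeasurable (by fun_prop)) (Eventually.of_forall fun U => ?_)
    have hth : 0 ≤ ((1 + ‖U‖ ^ 2) ^ 4)⁻¹ * Real.exp (-‖U‖ ^ 2 / R) := by positivity
    have hq : (1 + ‖U‖ ^ 2) ≠ 0 := by positivity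
    rw [Real.norm_eq_abs, abs_mul, abs_mul, abs_of_nonneg hth]
    calc |g U| * |U 0| * (((1 + ‖U‖ ^ 2) ^ 4)⁻¹ * Real.exp (-‖U‖ ^ 2 / R))
        ≤ C * (1 + ‖U‖ ^ 2) * ‖U‖ * (((1 + ‖U‖ ^ 2) ^ 4)⁻¹ * 1) := by
          gcongr
          · exact hgb U
          · exact hv0 U
          · exact he1 U
      _ = C * (‖U‖ * ((1 + ‖U‖ ^ 2) ^ 3)⁻¹) := by field_simp
  have hDb : |∫ U : V3, g U * U 0 * (((1 + ‖U‖ ^ 2) ^ 4)⁻¹ * Real.exp (-‖U‖ ^ 2 / R))| ≤ C * 20 := by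
    have h := norm_integral_le_of_norm_le (hDi.const_mul C)
      (f := fun U : V3 => g U * U 0 * (((1 + ‖U‖ ^ 2) ^ 4)⁻¹ * Real.exp (-‖U‖ ^ 2 / R)))
      (Eventually.of_forall fun U => by
        have hth : 0 ≤ ((1 + ‖U‖ ^ 2) ^ 4)⁻¹ * Real.exp (-‖U‖ ^ 2 / R) := by positivity
        have hq : (1 + ‖U‖ ^ 2) ≠ 0 := by positivity
        rw [Real.norm_eq_abs, abs_mul, abs_mul, abs_of_nonneg hth]
        calc |g U| * |U 0| * (((1 + ‖U‖ ^ 2) ^ 4)⁻¹ * Real.exp (-‖U‖ ^ 2 / R))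
            ≤ C * (1 + ‖U‖ ^ 2) * ‖U‖ * (((1 + ‖U‖ ^ 2) ^ 4)⁻¹ * 1) := by
              gcongr
              · exact hgb U
              · exact hv0 U
              · exact he1 U
          _ = C * (‖U‖ * ((1 + ‖U‖ ^ 2) ^ 3)⁻¹) := by field_simp)
    rw [integral_const_mul, Real.norm_eq_abs] at h
    exact h.trans (mul_le_mul_of_nonneg_left hDv hC)
  -- (e) pointwise algebra: `2G₁ − n ϑ₁ = e₁ − (π/5)(ϑ₀ − d)`
  have hpt : ∀ U : V3, 2 * (g U * (U 0 * G1 (‖U‖ ^ 2))) - g U * U 0 *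
      (collisionFrequency (Real.sqrt (‖U‖ ^ 2) • (EuclideanSpace.single 0 1 : V3)) *
        (Real.sqrt (‖U‖ ^ 2) * ((1 + ‖U‖ ^ 2) ^ 4)⁻¹ * Real.exp (-‖U‖ ^ 2 / R))) =
      g U * U 0 * e₁ (‖U‖ ^ 2) - Real.pi / 5 * (g U * U 0 * (((1 + ‖U‖ ^ 2) ^ 3)⁻¹ * Real.exp (-‖U‖ ^ 2 / R)) -
        g U * U 0 * (((1 + ‖U‖ ^ 2) ^ 4)⁻¹ * Real.exp (-‖U‖ ^ 2 / R))) := by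
    intro U
    have hw := k2r_ref_ok1_weight_identity R ‖U‖
    rw [he₁]
    linear_combination (-(Real.pi / 5)) * (g U * U 0) * hw
  have eK : (∫ U : V3, ((1 + ‖U‖ ^ 2) ^ 3)⁻¹ * Real.exp (-‖U‖ ^ 2 / R) * U 0 * g U) =
      ∫ U : V3, g U * U 0 * (((1 + ‖U‖ ^ 2) ^ 3)⁻¹ * Real.exp (-‖U‖ ^ 2 / R)) :=
    integral_congr_ae (Eventually.of_forall fun U => by ring)
  -- assemble
  have hKD : Integrable (fun U : V3 => g U * U 0 * (((1 + ‖U‖ ^ 2) ^ 3)⁻¹ * Real.exp (-‖U‖ ^ 2 / R)) -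
      g U * U 0 * (((1 + ‖U‖ ^ 2) ^ 4)⁻¹ * Real.exp (-‖U‖ ^ 2 / R))) := hK.sub hD
  have i0 := integral_congr_ae (μ := (volume : Measure V3)) (Eventually.of_forall hpt)
  have i1 := integral_sub (hA'.const_mul 2) hT'
  have i2 := integral_const_mul (μ := (volume : Measure V3)) 2 (fun U : V3 => g U * (U 0 * G1 (‖U‖ ^ 2)))
  have i3 := integral_sub hE (hKD.const_mul (Real.pi / 5))
  have i4 := integral_const_mul (μ := (volume : Measure V3)) (Real.pi / 5)
    (fun U : V3 => g U * U 0 * (((1 + ‖U‖ ^ 2) ^ 3)⁻¹ * Real.exp (-‖U‖ ^ 2 / R)) -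
      g U * U 0 * (((1 + ‖U‖ ^ 2) ^ 4)⁻¹ * Real.exp (-‖U‖ ^ 2 / R)))
  have i5 := integral_sub hK hD
  have hmain : 2 * (∫ U : V3, g U * (U 0 * G1 (‖U‖ ^ 2))) - (∫ U : V3, g U * U 0 *
      (collisionFrequency (Real.sqrt (‖U‖ ^ 2) • (EuclideanSpace.single 0 1 : V3)) *
        (Real.sqrt (‖U‖ ^ 2) * ((1 + ‖U‖ ^ 2) ^ 4)⁻¹ * Real.exp (-‖U‖ ^ 2 / R)))) =
      (∫ U : V3, g U * U 0 * e₁ (‖U‖ ^ 2)) - Real.pi / 5 *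
        ((∫ U : V3, g U * U 0 * (((1 + ‖U‖ ^ 2) ^ 3)⁻¹ * Real.exp (-‖U‖ ^ 2 / R))) -
          ∫ U : V3, g U * U 0 * (((1 + ‖U‖ ^ 2) ^ 4)⁻¹ * Real.exp (-‖U‖ ^ 2 / R))) := by
    rw [← i5, ← i4, ← i3, ← i0, i1, i2]
  rw [eA, eT, eK, hmain]
  have e : (∫ U : V3, g U * U 0 * e₁ (‖U‖ ^ 2)) - Real.pi / 5 *
        ((∫ U : V3, g U * U 0 * (((1 + ‖U‖ ^ 2) ^ 3)⁻¹ * Real.exp (-‖U‖ ^ 2 / R))) -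
          ∫ U : V3, g U * U 0 * (((1 + ‖U‖ ^ 2) ^ 4)⁻¹ * Real.exp (-‖U‖ ^ 2 / R))) +
      Real.pi / 5 * ∫ U : V3, g U * U 0 * (((1 + ‖U‖ ^ 2) ^ 3)⁻¹ * Real.exp (-‖U‖ ^ 2 / R)) =
      (∫ U : V3, g U * U 0 * e₁ (‖U‖ ^ 2)) +
        Real.pi / 5 * ∫ U : V3, g U * U 0 * (((1 + ‖U‖ ^ 2) ^ 4)⁻¹ * Real.exp (-‖U‖ ^ 2 / R)) := by ring
  rw [e]
  calc _ ≤ |∫ U : V3, g U * U 0 * e₁ (‖U‖ ^ 2)| +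
        |Real.pi / 5 * ∫ U : V3, g U * U 0 * (((1 + ‖U‖ ^ 2) ^ 4)⁻¹ * Real.exp (-‖U‖ ^ 2 / R))| := abs_add_le _ _
    _ ≤ C * (Real.pi * M₁) + Real.pi / 5 * (C * 20) := by
        rw [abs_mul, abs_of_pos (by positivity : (0 : ℝ) < Real.pi / 5)]
        gcongr
    _ = C * (Real.pi * M₁ + 4 * Real.pi) := by ring

end Summit.AtomisticToContinuum.HydrodynamicLimit.Theorems.EnskogAdjointDuality
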